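import Summits.RiemannHypothesis.RiemannHypothesis.Theorems.EtaLeadingQuarterSecondMomentZerosDiag
import HarnessLib

/-!
# The second moment of the sharp eta vector at the zeros, zero side V: transition zones
(route EtaLeadingQuarter, item `EtaLeadingSecondMoment`, stmt-RiemannHypothesis-21791)

`γ_n = zetaOrdinate n`, `N(T) = zetaZeroCount T`, `y_n = γ_n/(πM)` and `d_n = |y_n − round y_n|`, the
distance of `y_n` to the nearest integer: the stationary points of both pieces `∑_{n≤M} n^{-s}`,
`∑_{n≤M/2} n^{-s}` of the alternating sum cross the end-point exactly when `y_n ∈ ℤ`. The AFE engine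
(sibling files) bounds the per-zero error by `≍ M^{-1/2}/d_n` off the transition zones and by
`≍ (M/γ)^{1/2}` inside them; this file sums such weights over the zeros (RH-free, engine-independent):

* `count_window_le` — `N(t+h) − N(t) ≤ A (h+1) log(t+h+3)` from the unit-window density;
* `card_filter_abs_sub_le` — `#{n < N(T₂) : |γ_n − c| ≤ r} ≤ A (2r+2) log(c+r+3)`;
* `sum_eq_sum_fibre`, `card_fibre_le` — the fibres `round(y_n) = k`, `k = 1, …, ⌊T₂/(πM) + 1/2⌋`,
  each inside the window `|γ − kπM| ≤ πM h`;
* `inZone_le` — `∑_{n<N(T₂), y_n ≥ 1/2, d_n ≤ δ} M/γ_n³ ≤ A log(T₂ + πM + 3) (2δ/M + 1/M²)`.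

The off-zone sum `∑ 1/(γ_n² d_n²)` (dyadic levels in `d_n`) is part VI. Multiplied by the engine
constants these are `o(1)` for `δ = δ_M → 0` with `δ_M M/log M → ∞` (e.g. `δ_M ≍ M^{-1/2}`, the
natural zone width). Nothing here bears on the truth of RH.
-/

noncomputable section

open Real Finset Filter Topology

set_option linter.dupNamespace false  -- the mandated namespace repeats `RiemannHypothesis`

namespace Summit.RiemannHypothesis.RiemannHypothesis.Theorems.EtaLeadingQuarter.Zeros

open Literature.NumberTheory.LFunctions

/-! ## Counting zeros in windows -/

/-- From the unit-window density `N(t+1) − N(t) ≤ A log(t+2)` (`t ≥ 0`): for `m : ℕ`,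
`N(t+m) − N(t) ≤ m A log(t+m+2)`. [folklore] -/
theorem count_nat_window_le {A : ℝ} (hA0 : 0 ≤ A)
    (hA : ∀ t : ℝ, 0 ≤ t → (zetaZeroCount (t + 1) : ℝ) - zetaZeroCount t ≤ A * Real.log (t + 2))
    {t : ℝ} (ht : 0 ≤ t) (m : ℕ) :
    (zetaZeroCount (t + m) : ℝ) - zetaZeroCount t ≤ m * A * Real.log (t + m + 2) := by
  induction m with
  | zero => simp
  | succ m ih =>
    have hm0 : (0 : ℝ) ≤ m := Nat.cast_nonneg m
    have h1 := hA (t + m) (by positivity)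
    have hlog1 : Real.log (t + m + 2) ≤ Real.log (t + ((m : ℝ) + 1) + 2) :=
      Real.log_le_log (by positivity) (by linarith)
    have e : (zetaZeroCount (t + (m + 1 : ℕ)) : ℝ) = zetaZeroCount (t + m + 1) := by
      push_cast; ring_nf
    rw [e]
    push_cast
    have hprod : 0 ≤ ((m : ℝ) + 1) * A * (Real.log (t + ((m : ℝ) + 1) + 2) - Real.log (t + m + 2)) :=
      mul_nonneg (mul_nonneg (by positivity) hA0) (sub_nonneg.2 hlog1)
    nlinarith

/-- **Window count**: `N(t+h) − N(t) ≤ A (h+1) log(t+h+3)` for `t, h ≥ 0`. [folklore] -/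
theorem count_window_le {A : ℝ} (hA0 : 0 ≤ A)
    (hA : ∀ t : ℝ, 0 ≤ t → (zetaZeroCount (t + 1) : ℝ) - zetaZeroCount t ≤ A * Real.log (t + 2))
    {t h : ℝ} (ht : 0 ≤ t) (hh : 0 ≤ h) :
    (zetaZeroCount (t + h) : ℝ) - zetaZeroCount t ≤ A * (h + 1) * Real.log (t + h + 3) := by
  set m : ℕ := ⌈h⌉₊ with hm
  have hm1 : h ≤ m := Nat.le_ceil h
  have hm2 : (m : ℝ) ≤ h + 1 := (Nat.ceil_lt_add_one hh).le
  have hmono : (zetaZeroCount (t + h) : ℝ) ≤ zetaZeroCount (t + m) := by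
    exact_mod_cast zetaZeroCount_mono (by linarith)
  have h1 := count_nat_window_le hA0 hA ht m
  have hlog : Real.log (t + m + 2) ≤ Real.log (t + h + 3) := Real.log_le_log (by positivity) (by linarith)
  have hlog0 : 0 ≤ Real.log (t + m + 2) := Real.log_nonneg (by linarith)
  have hlog3 : 0 ≤ Real.log (t + h + 3) := Real.log_nonneg (by linarith)
  calc (zetaZeroCount (t + h) : ℝ) - zetaZeroCount t ≤ m * A * Real.log (t + m + 2) := by linarith
    _ ≤ (h + 1) * A * Real.log (t + h + 3) := by gcongr
    _ = A * (h + 1) * Real.log (t + h + 3) := by ring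

/-- **Indices in a window**: for `c − r ≥ 1`, `r ≥ 0`:
`#{n < N(T₂) : |γ_n − c| ≤ r} ≤ A (2r+2) log(c + r + 3)`. [folklore] -/
theorem card_filter_abs_sub_le {A : ℝ} (hA0 : 0 ≤ A)
    (hA : ∀ t : ℝ, 0 ≤ t → (zetaZeroCount (t + 1) : ℝ) - zetaZeroCount t ≤ A * Real.log (t + 2))
    {c r : ℝ} (hr : 0 ≤ r) (hcr : 1 ≤ c - r) (T₂ : ℝ) :
    (((Finset.range (zetaZeroCount T₂)).filter (fun n ↦ |zetaOrdinate n - c| ≤ r)).card : ℝ) ≤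
      A * (2 * r + 2) * Real.log (c + r + 3) := by
  have hsub : (Finset.range (zetaZeroCount T₂)).filter (fun n ↦ |zetaOrdinate n - c| ≤ r) ⊆
      Finset.Ico (zetaZeroCount (c - r - 1)) (zetaZeroCount (c + r)) := by
    intro n hn
    rw [Finset.mem_filter] at hn
    have h := abs_le.1 hn.2
    rw [Finset.mem_Ico]
    exact ⟨Montgomery.lt_zetaOrdinate_iff.1 (by linarith), Montgomery.zetaOrdinate_le_iff_lt.1 (by linarith)⟩
  have hcard := Finset.card_le_card hsub
  rw [Nat.card_Ico] at hcard
  have hw := count_window_le hA0 hA (t := c - r - 1) (h := 2 * r + 1) (by linarith) (by linarith)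
  have e1 : c - r - 1 + (2 * r + 1) = c + r := by ring
  rw [e1] at hw
  have hmono : zetaZeroCount (c - r - 1) ≤ zetaZeroCount (c + r) := zetaZeroCount_mono (by linarith)
  calc (((Finset.range (zetaZeroCount T₂)).filter (fun n ↦ |zetaOrdinate n - c| ≤ r)).card : ℝ)
      ≤ ((zetaZeroCount (c + r) - zetaZeroCount (c - r - 1) : ℕ) : ℝ) := by exact_mod_cast hcard
    _ = (zetaZeroCount (c + r) : ℝ) - zetaZeroCount (c - r - 1) := by rw [Nat.cast_sub hmono]
    _ ≤ A * (2 * r + 1 + 1) * Real.log (c + r + 3) := hw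
    _ = A * (2 * r + 2) * Real.log (c + r + 3) := by ring

/-! ## The fibres `round(γ_n/(πM)) = k` -/

/-- `∑_{k=1}^{K} 1/(k − 1/2)² ≤ π²/2`. [folklore] -/
theorem sum_inv_sub_half_sq_le (K : ℕ) :
    ∑ k ∈ Finset.Icc 1 K, 1 / ((k : ℝ) - 1 / 2) ^ 2 ≤ π ^ 2 / 2 := by
  have e : ∑ k ∈ Finset.Icc 1 K, 1 / ((k : ℝ) - 1 / 2) ^ 2 =
      ∑ i ∈ Finset.range K, 4 * (1 / (2 * (i : ℝ) + 1) ^ 2) := by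
    induction K with
    | zero => simp
    | succ K ih =>
      rw [Finset.sum_Icc_succ_top (by omega), ih, Finset.sum_range_succ]
      congr 1
      have h2 : ((K + 1 : ℕ) : ℝ) - 1 / 2 = (2 * (K : ℝ) + 1) / 2 := by push_cast; ring
      have h0 : (2 * (K : ℝ) + 1) ≠ 0 := by positivity
      rw [h2, div_pow, one_div_div]
      field_simp
      norm_num
  rw [e, ← Finset.mul_sum]
  have h := sum_le_hasSum (Finset.range K) (fun i _ ↦ by positivity)
    Literature.Analysis.SpecialFunctions.hasSum_one_div_odd_sq
  nlinarith [Real.pi_pos]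

/-- In the fibre `round(γ_n/(πM)) = k` (`k ≥ 1`): `γ_n ≥ πM(k − 1/2) > 0`. [folklore] -/
theorem fibre_lower {M : ℕ} (hM : 1 ≤ M) {n : ℕ} {k : ℕ}
    (hnk : round (zetaOrdinate n / (π * M)) = (k : ℤ)) :
    π * M * ((k : ℝ) - 1 / 2) ≤ zetaOrdinate n ∧
      |zetaOrdinate n - k * (π * M)| = π * M * |zetaOrdinate n / (π * M) - round (zetaOrdinate n / (π * M))| := by
  have hπM : 0 < π * (M : ℝ) := by
    have : (1 : ℝ) ≤ M := by exact_mod_cast hM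
    positivity
  have h1 := abs_sub_round (zetaOrdinate n / (π * M))
  rw [hnk] at h1 ⊢
  have h2 := (abs_le.1 h1).1
  push_cast at h2 ⊢
  constructor
  · rw [le_sub_iff_add_le, div_eq_mul_inv] at h2
    have := mul_le_mul_of_nonneg_left (show (k : ℝ) - 1 / 2 ≤ zetaOrdinate n / (π * M) by linarith) hπM.le
    rwa [mul_div_cancel₀ _ hπM.ne'] at this
  · rw [← abs_of_pos hπM, ← abs_mul, abs_of_pos hπM]
    congr 1
    field_simp

/-- **Fibre decomposition.** For nonnegative `f` and `S ⊆ {n < N(T₂) : γ_n/(πM) ≥ 1/2}`: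
`∑_{n ∈ S} f n = ∑_{k=1}^{K} ∑_{n ∈ S, round(γ_n/(πM)) = k} f n` with `K = ⌊T₂/(πM) + 1/2⌋₊`. [folklore] -/
theorem sum_eq_sum_fibre {M : ℕ} (hM : 1 ≤ M) {T₂ : ℝ} (hT₂ : 0 ≤ T₂) (f : ℕ → ℝ) {S : Finset ℕ}
    (hS : ∀ n ∈ S, n < zetaZeroCount T₂ ∧ 1 / 2 ≤ zetaOrdinate n / (π * M)) :
    ∑ n ∈ S, f n = ∑ k ∈ Finset.Icc 1 ⌊T₂ / (π * M) + 1 / 2⌋₊,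
      ∑ n ∈ S.filter (fun n ↦ round (zetaOrdinate n / (π * M)) = (k : ℤ)), f n := by
  classical
  have hπM : 0 < π * (M : ℝ) := by
    have : (1 : ℝ) ≤ M := by exact_mod_cast hM
    positivity
  symm
  have hmaps : ∀ n ∈ S, (round (zetaOrdinate n / (π * M))).toNat ∈ Finset.Icc 1 ⌊T₂ / (π * M) + 1 / 2⌋₊ := by
    intro n hn
    obtain ⟨h1, h2⟩ := hS n hn
    have hγ : zetaOrdinate n ≤ T₂ := Montgomery.zetaOrdinate_le_iff_lt.2 h1
    have hr1 : (1 : ℤ) ≤ round (zetaOrdinate n / (π * M)) := by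
      rw [round_eq]; exact Int.le_floor.2 (by push_cast; linarith)
    have hr2 : round (zetaOrdinate n / (π * M)) ≤ ⌊T₂ / (π * M) + 1 / 2⌋ := by
      rw [round_eq]; exact Int.floor_mono (by gcongr)
    rw [Finset.mem_Icc]
    constructor
    · have : (1 : ℤ) ≤ ((round (zetaOrdinate n / (π * M))).toNat : ℤ) := by
        rw [Int.toNat_of_nonneg (by linarith)]; exact hr1
      exact_mod_cast this
    · rw [Nat.le_floor_iff (by positivity)]
      have h3 : (((round (zetaOrdinate n / (π * M))).toNat : ℤ) : ℝ) ≤ ((⌊T₂ / (π * M) + 1 / 2⌋ : ℤ) : ℝ) := by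
        rw [Int.toNat_of_nonneg (by linarith)]; exact_mod_cast hr2
      have h4 : ((⌊T₂ / (π * M) + 1 / 2⌋ : ℤ) : ℝ) ≤ T₂ / (π * M) + 1 / 2 := Int.floor_le _
      have e : (((round (zetaOrdinate n / (π * M))).toNat : ℕ) : ℝ) =
          (((round (zetaOrdinate n / (π * M))).toNat : ℤ) : ℝ) := by norm_cast
      rw [e]; linarith
  rw [← Finset.sum_fiberwise_of_maps_to hmaps]
  refine Finset.sum_congr rfl fun k hk ↦ Finset.sum_congr ?_ fun _ _ ↦ rfl
  ext n
  simp only [Finset.mem_filter, and_congr_right_iff]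
  intro hn
  have hr0 : 0 ≤ round (zetaOrdinate n / (π * M)) := by
    rw [round_eq]; exact Int.le_floor.2 (by push_cast; linarith [(hS n hn).2])
  constructor
  · intro h
    rw [h]; simp
  · intro h
    rw [← h, Int.toNat_of_nonneg hr0]

/-- **One fibre**: if every `n ∈ S'` lies in the fibre `k ≥ 1` with `d_n ≤ h ≤ 1/2`, `n < N(T₂)`, then
`#S' ≤ A (2πMh + 2) log(T₂ + πM + 3)`. [folklore] -/
theorem card_fibre_le {A : ℝ} (hA0 : 0 ≤ A)
    (hA : ∀ t : ℝ, 0 ≤ t → (zetaZeroCount (t + 1) : ℝ) - zetaZeroCount t ≤ A * Real.log (t + 2))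
    {M : ℕ} (hM : 1 ≤ M) {T₂ h : ℝ} (hT₂ : 0 ≤ T₂) (hh0 : 0 ≤ h) (hh : h ≤ 1 / 2) {k : ℕ} (hk : 1 ≤ k)
    {S' : Finset ℕ} (hS' : ∀ n ∈ S', n < zetaZeroCount T₂ ∧ round (zetaOrdinate n / (π * M)) = (k : ℤ) ∧
      |zetaOrdinate n / (π * M) - round (zetaOrdinate n / (π * M))| ≤ h) :
    (S'.card : ℝ) ≤ A * (2 * (π * M * h) + 2) * Real.log (T₂ + π * M + 3) := by
  classical
  have hM1 : (1 : ℝ) ≤ M := by exact_mod_cast hM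
  have hπ := Real.pi_gt_three
  have hπM : 0 < π * (M : ℝ) := by positivity
  have hk1 : (1 : ℝ) ≤ k := by exact_mod_cast hk
  have hL0 : 0 ≤ Real.log (T₂ + π * M + 3) := Real.log_nonneg (by linarith)
  by_cases hne : S' = ∅
  · rw [hne, Finset.card_empty, Nat.cast_zero]
    positivity
  -- a member gives `kπM ≤ T₂ + πM/2`
  obtain ⟨n₀, hn₀⟩ := Finset.nonempty_iff_ne_empty.2 hne
  obtain ⟨hn₀N, hn₀k, -⟩ := hS' n₀ hn₀
  have hγ₀ : zetaOrdinate n₀ ≤ T₂ := Montgomery.zetaOrdinate_le_iff_lt.2 hn₀N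
  have hk_up : (k : ℝ) * (π * M) ≤ T₂ + π * M / 2 := by
    have h1 := abs_sub_round (zetaOrdinate n₀ / (π * M))
    rw [hn₀k] at h1
    have h2 := (abs_le.1 h1).1
    push_cast at h2
    have : (k : ℝ) ≤ zetaOrdinate n₀ / (π * M) + 1 / 2 := by linarith
    have := mul_le_mul_of_nonneg_right this hπM.le
    rw [add_mul, div_mul_cancel₀ _ hπM.ne'] at this
    linarith
  -- the fibre sits in the window `|γ − kπM| ≤ πMh`
  have hsub : S' ⊆ (Finset.range (zetaZeroCount T₂)).filter
      (fun n ↦ |zetaOrdinate n - k * (π * M)| ≤ π * M * h) := by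
    intro n hn
    obtain ⟨h1, h2, h3⟩ := hS' n hn
    rw [Finset.mem_filter, Finset.mem_range]
    refine ⟨h1, ?_⟩
    rw [(fibre_lower hM h2).2]
    exact mul_le_mul_of_nonneg_left h3 hπM.le
  have hcr : 1 ≤ (k : ℝ) * (π * M) - π * M * h := by nlinarith
  have hcount := card_filter_abs_sub_le hA0 hA (c := (k : ℝ) * (π * M)) (r := π * M * h)
    (by positivity) hcr T₂
  have hlog : Real.log ((k : ℝ) * (π * M) + π * M * h + 3) ≤ Real.log (T₂ + π * M + 3) :=
    Real.log_le_log (by positivity) (by nlinarith)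
  calc (S'.card : ℝ) ≤ (((Finset.range (zetaZeroCount T₂)).filter
        (fun n ↦ |zetaOrdinate n - k * (π * M)| ≤ π * M * h)).card : ℝ) := by
        exact_mod_cast Finset.card_le_card hsub
    _ ≤ A * (2 * (π * M * h) + 2) * Real.log ((k : ℝ) * (π * M) + π * M * h + 3) := hcount
    _ ≤ A * (2 * (π * M * h) + 2) * Real.log (T₂ + π * M + 3) := by gcongr

/-! ## Inside the transition zones -/

/-- **In-zone weights.** For `M ≥ 1`, `0 ≤ δ ≤ 1/2` and the local density constant `A`:
`∑_{n<N(T₂), γ_n/(πM) ≥ 1/2, d_n ≤ δ} M/γ_n³ ≤ A log(T₂ + πM + 3)·(2δ/M + 1/M²)`. [folklore] -/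
theorem inZone_le {A : ℝ} (hA0 : 0 ≤ A)
    (hA : ∀ t : ℝ, 0 ≤ t → (zetaZeroCount (t + 1) : ℝ) - zetaZeroCount t ≤ A * Real.log (t + 2))
    {M : ℕ} (hM : 1 ≤ M) {δ : ℝ} (hδ0 : 0 ≤ δ) (hδ : δ ≤ 1 / 2) {T₂ : ℝ} (hT₂ : 0 ≤ T₂) :
    ∑ n ∈ (Finset.range (zetaZeroCount T₂)).filter (fun n ↦ 1 / 2 ≤ zetaOrdinate n / (π * M) ∧
        |zetaOrdinate n / (π * M) - round (zetaOrdinate n / (π * M))| ≤ δ),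
      (M : ℝ) / zetaOrdinate n ^ 3 ≤
      A * Real.log (T₂ + π * M + 3) * (2 * δ / M + 1 / (M : ℝ) ^ 2) := by
  classical
  have hM1 : (1 : ℝ) ≤ M := by exact_mod_cast hM
  have hπ := Real.pi_gt_three
  have hπM : 0 < π * (M : ℝ) := by positivity
  set S := (Finset.range (zetaZeroCount T₂)).filter (fun n ↦ 1 / 2 ≤ zetaOrdinate n / (π * M) ∧
    |zetaOrdinate n / (π * M) - round (zetaOrdinate n / (π * M))| ≤ δ) with hS
  have hSmem : ∀ n ∈ S, n < zetaZeroCount T₂ ∧ 1 / 2 ≤ zetaOrdinate n / (π * M) := by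
    intro n hn
    rw [hS, Finset.mem_filter, Finset.mem_range] at hn
    exact ⟨hn.1, hn.2.1⟩
  have hL0 : 0 ≤ Real.log (T₂ + π * M + 3) := Real.log_nonneg (by linarith)
  set cnt : ℝ := A * (2 * (π * M * δ) + 2) * Real.log (T₂ + π * M + 3) with hcnt
  have hcnt0 : 0 ≤ cnt := by positivity
  rw [sum_eq_sum_fibre hM hT₂ (fun n ↦ (M : ℝ) / zetaOrdinate n ^ 3) hSmem]
  -- each fibre
  have hfib : ∀ k ∈ Finset.Icc 1 ⌊T₂ / (π * M) + 1 / 2⌋₊,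
      ∑ n ∈ S.filter (fun n ↦ round (zetaOrdinate n / (π * M)) = (k : ℤ)), (M : ℝ) / zetaOrdinate n ^ 3 ≤
        cnt * ((M : ℝ) / (π * M * ((k : ℝ) - 1 / 2)) ^ 3) := by
    intro k hk
    rw [Finset.mem_Icc] at hk
    have hk1 : (1 : ℝ) ≤ k := by exact_mod_cast hk.1
    have hlow : 0 < π * M * ((k : ℝ) - 1 / 2) := by nlinarith
    have hpt : ∀ n ∈ S.filter (fun n ↦ round (zetaOrdinate n / (π * M)) = (k : ℤ)),
        (M : ℝ) / zetaOrdinate n ^ 3 ≤ (M : ℝ) / (π * M * ((k : ℝ) - 1 / 2)) ^ 3 := by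
      intro n hn
      rw [Finset.mem_filter] at hn
      have h := (fibre_lower hM hn.2).1
      exact div_le_div_of_nonneg_left (by positivity) (by positivity) (pow_le_pow_left₀ hlow.le h 3)
    have hcard : ((S.filter (fun n ↦ round (zetaOrdinate n / (π * M)) = (k : ℤ))).card : ℝ) ≤ cnt := by
      refine card_fibre_le hA0 hA hM hT₂ hδ0 hδ hk.1 fun n hn ↦ ?_
      rw [Finset.mem_filter, hS, Finset.mem_filter, Finset.mem_range] at hn
      exact ⟨hn.1.1, hn.2, hn.1.2.2⟩
    calc ∑ n ∈ S.filter (fun n ↦ round (zetaOrdinate n / (π * M)) = (k : ℤ)), (M : ℝ) / zetaOrdinate n ^ 3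
        ≤ ∑ n ∈ S.filter (fun n ↦ round (zetaOrdinate n / (π * M)) = (k : ℤ)),
            (M : ℝ) / (π * M * ((k : ℝ) - 1 / 2)) ^ 3 := Finset.sum_le_sum hpt
      _ = ((S.filter (fun n ↦ round (zetaOrdinate n / (π * M)) = (k : ℤ))).card : ℝ) *
            ((M : ℝ) / (π * M * ((k : ℝ) - 1 / 2)) ^ 3) := by rw [Finset.sum_const, nsmul_eq_mul]
      _ ≤ cnt * ((M : ℝ) / (π * M * ((k : ℝ) - 1 / 2)) ^ 3) :=
          mul_le_mul_of_nonneg_right hcard (by positivity)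
  refine (Finset.sum_le_sum hfib).trans ?_
  rw [← Finset.mul_sum]
  -- `∑_k M/(πM(k−1/2))³ ≤ (2/(π³M²)) ∑ 1/(k−1/2)² ≤ 1/(π M²)`
  have hk3 : ∀ k ∈ Finset.Icc 1 ⌊T₂ / (π * M) + 1 / 2⌋₊,
      (M : ℝ) / (π * M * ((k : ℝ) - 1 / 2)) ^ 3 ≤ 2 / (π ^ 3 * (M : ℝ) ^ 2) * (1 / ((k : ℝ) - 1 / 2) ^ 2) := by
    intro k hk
    rw [Finset.mem_Icc] at hk
    have hk1 : (1 : ℝ) ≤ k := by exact_mod_cast hk.1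
    have hkh : 0 < (k : ℝ) - 1 / 2 := by linarith
    have e : (M : ℝ) / (π * M * ((k : ℝ) - 1 / 2)) ^ 3 =
        1 / (π ^ 3 * (M : ℝ) ^ 2) * (1 / ((k : ℝ) - 1 / 2) ^ 2) * (1 / ((k : ℝ) - 1 / 2)) := by
      field_simp
    have h2 : 1 / ((k : ℝ) - 1 / 2) ≤ 2 := by
      rw [div_le_iff₀ hkh]; linarith
    rw [e]
    calc 1 / (π ^ 3 * (M : ℝ) ^ 2) * (1 / ((k : ℝ) - 1 / 2) ^ 2) * (1 / ((k : ℝ) - 1 / 2))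
        ≤ 1 / (π ^ 3 * (M : ℝ) ^ 2) * (1 / ((k : ℝ) - 1 / 2) ^ 2) * 2 := by gcongr
      _ = 2 / (π ^ 3 * (M : ℝ) ^ 2) * (1 / ((k : ℝ) - 1 / 2) ^ 2) := by ring
  have hsum : ∑ k ∈ Finset.Icc 1 ⌊T₂ / (π * M) + 1 / 2⌋₊, (M : ℝ) / (π * M * ((k : ℝ) - 1 / 2)) ^ 3 ≤
      2 / (π ^ 3 * (M : ℝ) ^ 2) * (π ^ 2 / 2) := by
    refine (Finset.sum_le_sum hk3).trans ?_
    rw [← Finset.mul_sum]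
    exact mul_le_mul_of_nonneg_left (sum_inv_sub_half_sq_le _) (by positivity)
  calc cnt * ∑ k ∈ Finset.Icc 1 ⌊T₂ / (π * M) + 1 / 2⌋₊, (M : ℝ) / (π * M * ((k : ℝ) - 1 / 2)) ^ 3
      ≤ cnt * (2 / (π ^ 3 * (M : ℝ) ^ 2) * (π ^ 2 / 2)) := mul_le_mul_of_nonneg_left hsum hcnt0
    _ = A * Real.log (T₂ + π * M + 3) * ((2 * (π * M * δ) + 2) / (π * (M : ℝ) ^ 2)) := by
        rw [hcnt]; field_simp
    _ ≤ A * Real.log (T₂ + π * M + 3) * (2 * δ / M + 1 / (M : ℝ) ^ 2) := by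
        refine mul_le_mul_of_nonneg_left ?_ (by positivity)
        have e : (2 * (π * M * δ) + 2) / (π * (M : ℝ) ^ 2) = 2 * δ / M + 2 / (π * (M : ℝ) ^ 2) := by
          field_simp
        rw [e]
        have : 2 / (π * (M : ℝ) ^ 2) ≤ 1 / (M : ℝ) ^ 2 := by
          rw [div_le_div_iff₀ (by positivity) (by positivity)]; nlinarith [sq_nonneg (M : ℝ)]
        linarith

end Summit.RiemannHypothesis.RiemannHypothesis.Theorems.EtaLeadingQuarter.Zeros

end
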